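import Literature.AnabelianGeometry.EtaleTheta.ThetaFrobenioid
import Literature.AnabelianGeometry.EtaleTheta.Discharge.Sec3Remark364

/-!
# [EtTh] §3 discharge: Example 3.9 (iii) — the printed recipe for `Φ_W^ell` as a subfunctor in monoids,
# reduced to its inputs

S. Mochizuki, *The étale theta function and its Frobenioid-theoretic manifestations*, Publ. RIMS **45**
(2009) [MochizukiEtTh2009], Example 3.9 (iii), PDF p. 84 (printed 310) [cite: MochizukiEtTh2009, Ex 3.9 p.84]:
"Now define `Φ^ell_{W^ell} ⊆ Φ_W|_{D_W^ell}` as follows: For `A ∈ Ob(D_W^ell)`, we take `Φ^ell_{W^ell}(A)` to be the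
perf-saturation [cf. §0] in `Φ_W(A)` of the submonoid `lim→ Div⁺(Z^log_∞)^{Gal(Z^log_∞/A)} ⊆ Φ_W(A)` … Set
`Φ_W^ell := Φ^ell_{W^ell}|_{D_W} ⊆ (Φ_W|_{D_W^ell})|_{D_W} ⊆ Φ_W` — where '`|_{D_W}`' is with respect to the functor
`D_W → D_W^ell` defined in (ii).  Now observe that `Φ_W^ell` is a perfect [cf. the definition of `Φ^ell_{W^ell}` as a
perf-saturation inside the perfect monoid `Φ_W|_{D_W^ell}` on `D_W^ell`] and [manifestly — cf. Remark 3.6.1]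
group-saturated submonoid of the monoid `Φ_W` on `D_W`, which is, moreover, perf-factorial, non-dilating
[cf. Proposition 3.4, (i) …], and cuspidally pure …".

abc-iut cell, block C (W6 cone prover abc-iut-w6-d061, tranche 2), node EtTh:Ex3.9(iii) (kernel id
`N_EtTh_Ex3_9_iii`, index declaration `SubMonoidOn.restrict`).  PROOF-ONLY companion (no `def`, no `Prop` fact)
of abc-iut-L2-t3's `ThetaFrobenioid.lean`, where Example 3.9 (iii) is DATA: the field
`Example39Data.ΦellW : SubMonoidOn TW.ΦR` with its four printed properties as hypothesis fields, and the
operation "`|_{D_α}`, `|_{D_W}`" is `SubMonoidOn.restrict`.  Nothing landed is edited or restated.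

WHAT IS PROVED — the functorial glue that the printed recipe uses silently, over the tree's §0 notions
`perfSaturation`, `groupSaturation` (`Conventions.lean`) and `SubMonoidOn` (`TemperedFrobenioid.lean`):

* `SubMonoidOn.map_mem_perfSaturation`, `SubMonoidOn.map_mem_groupSaturation` — the objectwise perf-saturations
  (resp. group-saturations) of a subfunctor in monoids are again stable under pull-back, hence
  `SubMonoidOn.exists_perfSaturation`: the recipe "`A ↦` perf-saturation of `P(A)` in `Ψ(A)`" IS a subfunctor
  in monoids (print's "`Φ^ell_{W^ell} ⊆ Φ_W|_{D_W^ell}`" as a functor, not only objectwise);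
* `SubMonoidOn.exists_perfSaturation_restrict` — "`Φ^ell_{W^ell}|_{D_W}`": the same after restriction along ANY
  functor `L : D_W ⥤ D_W^ell` (the index declaration `SubMonoidOn.restrict`), with its values
  perfect when `Ψ` has perfect values (`isPerfect_of_eq_perfSaturation`, print's first bracket, via abc-iut-L2-d2's
  `Lemma35.isPerfect_perfSaturation`), perf-saturated (`isPerfSaturated_of_eq_perfSaturation`), group-saturated
  resp. perf-factorial as soon as the INPUT submonoid `P(L A)` is (`isGroupSaturated_of_eq_perfSaturation`,
  Lemma 3.5 (ii) = abc-iut-L6-t12's `Lemma35.isGroupSaturated_perfSaturation`; `isPerfFactorial_of_eq_perfSaturation`,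
  print's "[cf. Proposition 3.4, (i)]" = the `Div⁺` monoids are perf-factorial, via abc-iut-L2-d2's
  `isPerfFactorial_perfSaturation_of_isPerfect`);
* `SubMonoidOn.exists_map_along_unit` — the last inclusion "`(Φ_W|_{D_W^ell})|_{D_W} ⊆ Φ_W`": a subfunctor in
  monoids of `G^op ⋙ Ψ` is carried to a subfunctor in monoids of `Ψ` by pulling back along a natural
  transformation `η : 𝟭 ⟶ G` (here: the unit `A → (A^ell ⊆ D_W)` of the adjunction of (ii)), and perfection of
  the values survives when the `n`-th power maps of `Ψ(A)` are injective (`isPerfect_map_of_pow_injective`);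
* `RealifiedDivisorMonoids.isPerfect_ΦR` — at the tree's [FrdI] vocabulary `treeMonoidVocab`, every `Φ₀^ℝ(Y)` is
  perfect (it IS a realification: `IsRealificationVia` + abc-iut-L1's `IsPerfFactorial.Rlf.isPerfect`) — print's
  "the perfect monoid `Φ_W`" for the ambient realified monoid of Def. 3.6 (i);
* `Example39Data.exists_subMonoidOn_of_recipe`, `Example39Data.isPerfect_recipe` — assembled at abc-iut-L2-t3's
  datum `E : Example39Data V D_W TW`: from ANY subfunctor in monoids `P ⊆ Φ_W^ℝ|_{D_W^ell}` on `E`'s `D_W^ell`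
  (the slot of `lim→ Div⁺(Z^log_∞)^{Gal}`), the printed recipe (perf-saturate, restrict along `E.toEllW`, pull back
  along the unit of `E.adjW`) yields a term of the TYPE of the field `ΦellW` whose carrier is given by that
  recipe, with perfect values at `V = treeMonoidVocab`.

HONEST FRAMING.  This is monoid and functor bookkeeping over abstract data: nothing here constructs the
`lim→ Div⁺` subfunctor of a curve, and the clauses "group-saturated [manifestly]", "non-dilating", "cuspidally
pure", "independent of the choice of tempered filter" of (iii) rest on the structure of the special fibres of the
universal combinatorial coverings (p. 84) and are NOT touched (they stay the hypothesis fields of `Example39Data`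
and the named fact `Example39_iv_cuspidallyPure`).  [EtTh] is refereed pre-IUT material; nothing here bears on
[IUTchIII] Cor. 3.12 — no side is taken; typed ≠ proved.
-/

namespace Literature.AnabelianGeometry.EtaleTheta

open CategoryTheory Opposite Literature.AlgebraicGeometry.Frobenioids Function

universe u' v' u v w u₀ v₀

/-! ### Two monoid lemmas -/

/-- The perf-saturation is perf-saturated (idempotence of `P ↦ P^pf ∩ Q`, §0 p. 8).
[cite: MochizukiEtTh2009, §0 p.8] -/
theorem isPerfSaturated_perfSaturation {Q : Type w} [CommMonoid Q] (P : Submonoid Q) :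
    IsPerfSaturated (perfSaturation P) := by
  refine ⟨fun q hq => ?_⟩
  obtain ⟨n, m, hm⟩ := hq
  refine ⟨n * m, ?_⟩
  rw [PNat.mul_coe, pow_mul]
  exact hm

/-- A perfect monoid has injective `n`-th power maps, `n ≥ 1` (half of `IsPerfect`).
[cite: MochizukiFrdI2008, §0 p.11] -/
theorem pow_injective_of_isPerfect {N : Type w} [CommMonoid N] (hN : IsPerfect N) (n : ℕ) (hn : 0 < n) :
    Injective fun y : N => y ^ n :=
  (hN.bijective_pow n hn).1

/-- The image of a PERFECT submonoid under a monoid homomorphism is perfect as soon as the `n`-th power maps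
(`n ≥ 1`) of the target are injective (e.g. the target is perfect): `n`-th roots are carried along, and
uniqueness of roots is inherited from the target (bookkeeping for [FrdI] §0's "perfect": "multiplication by
every `n ∈ ℕ_{≥1}` is bijective"). [cite: MochizukiFrdI2008, §0 p.11] -/
theorem isPerfect_map_of_pow_injective {M N : Type w} [CommMonoid M] [CommMonoid N] (φ : M →* N)
    (hN : ∀ n : ℕ, 0 < n → Injective fun y : N => y ^ n) {S : Submonoid M} (hS : IsPerfect S) :
    IsPerfect ↥(S.map φ) := by
  refine ⟨fun n hn => ⟨fun a b hab => ?_, fun y => ?_⟩⟩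
  · apply Subtype.ext
    apply hN n hn
    simpa only [SubmonoidClass.coe_pow] using congrArg Subtype.val hab
  · obtain ⟨x, hx, hxy⟩ := Submonoid.mem_map.mp y.2
    obtain ⟨r, hr⟩ := (hS.bijective_pow n hn).2 ⟨x, hx⟩
    refine ⟨⟨φ r, Submonoid.mem_map_of_mem φ r.2⟩, Subtype.ext ?_⟩
    have hr' : (r : M) ^ n = x := by
      simpa only [SubmonoidClass.coe_pow] using congrArg Subtype.val hr
    simp only [SubmonoidClass.coe_pow]
    rw [← map_pow, hr', hxy]

/-! ### Subfunctors in monoids: saturations, restriction, transport along a natural transformation -/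

namespace SubMonoidOn

variable {D : Type u} [Category.{v} D] {Ψ : Dᵒᵖ ⥤ CommMonCat.{w}} (S : SubMonoidOn Ψ)

/-- **The objectwise perf-saturations of a subfunctor in monoids are stable under pull-back**: if `q^n ∈ Φ(A)`
then `(Ψ(f) q)^n = Ψ(f)(q^n) ∈ Φ(B)`.  This is what makes print's recipe "`Φ^ell_{W^ell}(A) :=` the
perf-saturation in `Φ_W(A)` of [a submonoid functorial in `A`]" a subfunctor in monoids
`Φ^ell_{W^ell} ⊆ Φ_W|_{D_W^ell}` (Example 3.9 (iii), p. 84). [cite: MochizukiEtTh2009, Ex 3.9 p.84] -/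
theorem map_mem_perfSaturation {A B : Dᵒᵖ} (f : A ⟶ B) (q : Ψ.obj A)
    (hq : q ∈ perfSaturation (S.carrier A)) : (Ψ.map f).hom q ∈ perfSaturation (S.carrier B) := by
  obtain ⟨n, hn⟩ := hq
  exact ⟨n, by rw [← map_pow]; exact S.map_mem f _ hn⟩

/-- The objectwise group-saturations of a subfunctor in monoids are stable under pull-back: `q · b = a` with
`a, b ∈ Φ(A)` gives `Ψ(f)q · Ψ(f)b = Ψ(f)a`.  (Def. 3.6 (ii) asks `Φ ⊆ Φ^{ℝ-log}` to be group-saturated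
objectwise; Example 3.9 (iii): "`Φ_W^ell` is … [manifestly — cf. Remark 3.6.1] group-saturated".)
[cite: MochizukiEtTh2009, Ex 3.9 p.84] -/
theorem map_mem_groupSaturation {A B : Dᵒᵖ} (f : A ⟶ B) (q : Ψ.obj A)
    (hq : q ∈ groupSaturation (S.carrier A)) : (Ψ.map f).hom q ∈ groupSaturation (S.carrier B) := by
  obtain ⟨a, ha, b, hb, h⟩ := hq
  exact ⟨(Ψ.map f).hom a, S.map_mem f a ha, (Ψ.map f).hom b, S.map_mem f b hb, by rw [← map_mul, h]⟩

/-- **The perf-saturated subfunctor exists**: for every subfunctor in monoids `P ⊆ Ψ` there is a subfunctor in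
monoids `T ⊆ Ψ` with `T(A) =` the perf-saturation of `P(A)` in `Ψ(A)` for every `A` — print's
"`Φ^ell_{W^ell} ⊆ Φ_W|_{D_W^ell}`" (Example 3.9 (iii), p. 84) as a functor. [cite: MochizukiEtTh2009, Ex 3.9 p.84] -/
theorem exists_perfSaturation : ∃ T : SubMonoidOn Ψ, ∀ A : Dᵒᵖ, T.carrier A = perfSaturation (S.carrier A) :=
  ⟨⟨fun A => perfSaturation (S.carrier A), fun f q hq => S.map_mem_perfSaturation f q hq⟩, fun _ => rfl⟩

/-- The group-saturated subfunctor exists likewise (the "group-saturation" of §0 p. 8, objectwise).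
[cite: MochizukiEtTh2009, §0 p.8] -/
theorem exists_groupSaturation :
    ∃ T : SubMonoidOn Ψ, ∀ A : Dᵒᵖ, T.carrier A = groupSaturation (S.carrier A) :=
  ⟨⟨fun A => groupSaturation (S.carrier A), fun f q hq => S.map_mem_groupSaturation f q hq⟩, fun _ => rfl⟩

variable {D' : Type u'} [Category.{v'} D']

/-- Values of the restriction `Φ|_{D'}` along `L : D' ⥤ D` (the index declaration `SubMonoidOn.restrict` of node
EtTh:Ex3.9(iii)): `(Φ|_{D'})(A) = Φ(L A)`. [cite: MochizukiEtTh2009, Ex 3.9 p.84] -/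
@[simp] theorem restrict_carrier (L : D' ⥤ D) (A : D'ᵒᵖ) :
    (S.restrict L).carrier A = S.carrier (L.op.obj A) := rfl

/-- **"`Φ_W^ell := Φ^ell_{W^ell}|_{D_W}`" exists as a subfunctor in monoids**: for every subfunctor in monoids
`P ⊆ Ψ` on `D` (`D = D_W^ell`, `Ψ = Φ_W|_{D_W^ell}`) and every functor `L : D' ⥤ D` (`D' = D_W`, `L` the functor of
(ii)), there is a subfunctor in monoids `T ⊆ Ψ|_{D'}` with `T(A) =` the perf-saturation of `P(L A)` in `Ψ(L A)`
— namely the restriction (`SubMonoidOn.restrict`) of the perf-saturated subfunctor.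
[cite: MochizukiEtTh2009, Ex 3.9 p.84] -/
theorem exists_perfSaturation_restrict (L : D' ⥤ D) :
    ∃ T : SubMonoidOn (L.op ⋙ Ψ), ∀ A : D'ᵒᵖ, T.carrier A = perfSaturation (S.carrier (L.op.obj A)) := by
  obtain ⟨T, hT⟩ := S.exists_perfSaturation
  exact ⟨T.restrict L, fun A => hT (L.op.obj A)⟩

/-! #### Properties of the values of any subfunctor given by the recipe `T(A) = (P(L A))^pf ∩ Ψ(L A)` -/

variable {L : D' ⥤ D} {T : SubMonoidOn (L.op ⋙ Ψ)}

/-- **"`Φ_W^ell` is perfect [cf. the definition of `Φ^ell_{W^ell}` as a perf-saturation inside the perfect monoid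
`Φ_W|_{D_W^ell}` on `D_W^ell`]"** (p. 84): if `Ψ` has perfect values, so does every subfunctor given by the recipe
(abc-iut-L2-d2's `Lemma35.isPerfect_perfSaturation`). [cite: MochizukiEtTh2009, Ex 3.9 p.84] -/
theorem isPerfect_of_eq_perfSaturation
    (hT : ∀ A : D'ᵒᵖ, T.carrier A = perfSaturation (S.carrier (L.op.obj A)))
    (hΨ : ∀ B : Dᵒᵖ, IsPerfect (Ψ.obj B)) (A : D'ᵒᵖ) : IsPerfect ↥(T.carrier A) := by
  rw [hT A]
  exact Lemma35.isPerfect_perfSaturation (hΨ _) _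

/-- The values given by the recipe are perf-saturated in `Ψ(L A)` (§0 p. 8). [cite: MochizukiEtTh2009, §0 p.8] -/
theorem isPerfSaturated_of_eq_perfSaturation
    (hT : ∀ A : D'ᵒᵖ, T.carrier A = perfSaturation (S.carrier (L.op.obj A))) (A : D'ᵒᵖ) :
    IsPerfSaturated (Q := (L.op ⋙ Ψ).obj A) (T.carrier A) := by
  rw [hT A]
  exact isPerfSaturated_perfSaturation _

/-- "group-saturated" for the values given by the recipe, REDUCED TO ITS INPUT: it holds as soon as the input
submonoid `P(L A)` is group-saturated in `Ψ(L A)` (Lemma 3.5 (ii), `P^pf` portion — abc-iut-L6-t12's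
`Lemma35.isGroupSaturated_perfSaturation`; print's "[manifestly — cf. Remark 3.6.1]" supplies that input from
the effectivity of divisors, which is not typed). [cite: MochizukiEtTh2009, Ex 3.9 p.84] -/
theorem isGroupSaturated_of_eq_perfSaturation
    (hT : ∀ A : D'ᵒᵖ, T.carrier A = perfSaturation (S.carrier (L.op.obj A))) (A : D'ᵒᵖ)
    (hP : IsGroupSaturated (Q := Ψ.obj (L.op.obj A)) (S.carrier (L.op.obj A))) :
    IsGroupSaturated (Q := (L.op ⋙ Ψ).obj A) (T.carrier A) := by
  rw [hT A]
  exact Lemma35.isGroupSaturated_perfSaturation _ hP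

/-- "perf-factorial" for the values given by the recipe, REDUCED TO ITS INPUT "[cf. Proposition 3.4, (i)]": it
holds as soon as `Ψ(L A)` is perfect and the input submonoid `P(L A)` is perf-factorial (the tree's [FrdI]
Def. 2.4 (i) `IsPerfFactorial`; abc-iut-L2-d2's `isPerfFactorial_perfSaturation_of_isPerfect`).
[cite: MochizukiEtTh2009, Ex 3.9 p.84] -/
theorem isPerfFactorial_of_eq_perfSaturation
    (hT : ∀ A : D'ᵒᵖ, T.carrier A = perfSaturation (S.carrier (L.op.obj A))) (A : D'ᵒᵖ)
    (hΨ : IsPerfect (Ψ.obj (L.op.obj A))) (hP : IsPerfFactorial ↥(S.carrier (L.op.obj A))) :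
    IsPerfFactorial ↥(T.carrier A) := by
  rw [hT A]
  exact isPerfFactorial_perfSaturation_of_isPerfect hΨ hP

/-! #### "`(Φ_W|_{D_W^ell})|_{D_W} ⊆ Φ_W`": transport along a natural transformation `𝟭 ⟶ G` -/

/-- **Transport of a subfunctor in monoids along `η : 𝟭 ⟶ G`.**  For `G : D ⥤ D`, a natural transformation
`η : 𝟭_D ⟶ G` and a subfunctor in monoids `T ⊆ Ψ|_G = G^op ⋙ Ψ`, the images `Ψ(η_A)(T(A)) ⊆ Ψ(A)` form a
subfunctor in monoids of `Ψ` (stability under pull-back is the naturality square of `η`).  In Example 3.9 (iii)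
`G = (D_W → D_W^ell ⊆ D_W)`, `η` is the unit `A → A^ell` of the adjunction of (ii), and this is the displayed
inclusion "`(Φ_W|_{D_W^ell})|_{D_W} ⊆ Φ_W`" defining `Φ_W^ell ⊆ Φ_W` (p. 84). [cite: MochizukiEtTh2009, Ex 3.9 p.84] -/
theorem exists_map_along_unit (G : D ⥤ D) (η : 𝟭 D ⟶ G) (T : SubMonoidOn (G.op ⋙ Ψ)) :
    ∃ T' : SubMonoidOn Ψ, ∀ A : D,
      T'.carrier (op A) = (T.carrier (op A)).map (Ψ.map (η.app A).op).hom := by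
  refine ⟨⟨fun A => (T.carrier A).map (Ψ.map (η.app (unop A)).op).hom, ?_⟩, fun A => rfl⟩
  intro A B f y hy
  obtain ⟨x, hx, rfl⟩ := Submonoid.mem_map.mp hy
  refine Submonoid.mem_map.mpr ⟨((G.op ⋙ Ψ).map f).hom x, T.map_mem f x hx, ?_⟩
  -- naturality of `η` at `f.unop : unop B ⟶ unop A`, pushed through `Ψ` and evaluated at `x`
  have h1 := congrArg (fun φ : (𝟭 D).obj (unop B) ⟶ G.obj (unop A) => (Ψ.map φ.op).hom x)
    (η.naturality f.unop)
  simp only [Functor.id_map, op_comp, Functor.map_comp, CommMonCat.hom_comp, MonoidHom.comp_apply] at h1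
  exact h1.symm

/-- Perfection of the values survives the transport when the `n`-th power maps of `Ψ(A)` are injective — in
particular when `Ψ(A)` is perfect (print: `Φ_W` is "the perfection of the monoid `Φ₀`", p. 84).
[cite: MochizukiEtTh2009, Ex 3.9 p.84] -/
theorem isPerfect_map_along_unit (G : D ⥤ D) (η : 𝟭 D ⟶ G) (T : SubMonoidOn (G.op ⋙ Ψ))
    {T' : SubMonoidOn Ψ} (hT' : ∀ A : D, T'.carrier (op A) = (T.carrier (op A)).map (Ψ.map (η.app A).op).hom)
    (hΨ : ∀ A : D, IsPerfect (Ψ.obj (op A))) (hT : ∀ A : D, IsPerfect ↥(T.carrier (op A))) (A : D) :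
    IsPerfect ↥(T'.carrier (op A)) := by
  rw [hT' A]
  exact isPerfect_map_of_pow_injective _ (pow_injective_of_isPerfect (hΨ A)) (hT A)

end SubMonoidOn

/-! ### Def. 3.6 (i) at the tree's vocabulary: `Φ₀^ℝ(Y)` is perfect -/

namespace RealifiedDivisorMonoids

variable {D₀ : Type u₀} [Category.{v₀} D₀] (T : RealifiedDivisorMonoids (D₀ := D₀) treeMonoidVocab.{w})

/-- **`Φ₀^ℝ(Y)` is perfect** for every realified datum over the tree's [FrdI] vocabulary (Def. 3.6 (i):
`Φ₀^ℝ := Φ₀^rlf`; at `treeMonoidVocab` the field `isRealification` is an isomorphism onto abc-iut-L1's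
realification `Φ₀(Y)^rlf`, which is perfect — `IsPerfFactorial.Rlf.isPerfect`).  Print (Ex. 3.9 (iii), p. 84):
"the perfect monoid `Φ_W|_{D_W^ell}`". [cite: MochizukiEtTh2009, Def 3.6 p.76] -/
theorem isPerfect_ΦR (Y : D₀ᵒᵖ) : IsPerfect (T.ΦR.obj Y) := by
  obtain ⟨h, e, -⟩ := T.isRealification Y
  exact (IsPerfFactorial.Rlf.isPerfect h).of_mulEquiv e.symm

end RealifiedDivisorMonoids

/-! ### Assembly at abc-iut-L2-t3's datum `Example39Data` -/

namespace Example39Data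

variable {V : FrdIMonoidStub.{w}} {DW : Type u} [Category.{v} DW] {TW : RealifiedDivisorMonoids (D₀ := DW) V}
  (E : Example39Data V DW TW)

/-- **Example 3.9 (iii), the recipe for `Φ_W^ell` yields a term of the type of the field `ΦellW`.**  For ANY
subfunctor in monoids `P ⊆ Φ_W^ℝ|_{D_W^ell}` on the datum's `D_W^ell` (the slot of print's
`lim→ Div⁺(Z^log_∞)^{Gal(Z^log_∞/A)}`, not constructed here) there is `T : SubMonoidOn TW.ΦR` — the TYPE of
`E.ΦellW` — with, for every `A ∈ Ob(D_W)`,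
`T(A) = Φ_W^ℝ(η_A)( perf-saturation of P(A^ell) in Φ_W^ℝ(A^ell) )`, where `A^ell := E.toEllW A` and
`η_A : A → A^ell` is the unit of the adjunction `E.adjW` of (ii): perf-saturate, restrict along `D_W → D_W^ell`
(`SubMonoidOn.restrict`), include into `Φ_W` along the unit. [cite: MochizukiEtTh2009, Ex 3.9 p.84] -/
theorem exists_subMonoidOn_of_recipe (P : SubMonoidOn (E.ellW.ι.op ⋙ TW.ΦR)) :
    ∃ T : SubMonoidOn TW.ΦR, ∀ A : DW,
      T.carrier (op A) = (perfSaturation (Q := TW.ΦR.obj (op (E.ellW.ι.obj (E.toEllW.obj A))))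
        (P.carrier (op (E.toEllW.obj A)))).map (TW.ΦR.map (E.adjW.unit.app A).op).hom := by
  obtain ⟨T₁, hT₁⟩ := P.exists_perfSaturation_restrict E.toEllW
  obtain ⟨T, hT⟩ :=
    SubMonoidOn.exists_map_along_unit (Ψ := TW.ΦR) (E.toEllW ⋙ E.ellW.ι) E.adjW.unit T₁
  refine ⟨T, fun A => ?_⟩
  rw [hT A, hT₁ (op A)]
  rfl

/-- **"`Φ_W^ell` is perfect"** for the recipe, at the tree's [FrdI] vocabulary: every `T` as in
`exists_subMonoidOn_of_recipe` has perfect values, for EVERY input `P` — `Φ_W^ℝ` has perfect values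
(`RealifiedDivisorMonoids.isPerfect_ΦR`), the perf-saturation inside a perfect monoid is perfect, restriction
changes nothing, and the unit transport lands in the perfect `Φ_W^ℝ(A)`. [cite: MochizukiEtTh2009, Ex 3.9 p.84] -/
theorem isPerfect_recipe {TW : RealifiedDivisorMonoids (D₀ := DW) treeMonoidVocab.{w}}
    (E : Example39Data treeMonoidVocab.{w} DW TW) (P : SubMonoidOn (E.ellW.ι.op ⋙ TW.ΦR))
    {T : SubMonoidOn TW.ΦR}
    (hT : ∀ A : DW, T.carrier (op A) =
      (perfSaturation (Q := TW.ΦR.obj (op (E.ellW.ι.obj (E.toEllW.obj A))))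
        (P.carrier (op (E.toEllW.obj A)))).map (TW.ΦR.map (E.adjW.unit.app A).op).hom)
    (A : DW) : IsPerfect ↥(T.carrier (op A)) := by
  rw [hT A]
  exact isPerfect_map_of_pow_injective _ (pow_injective_of_isPerfect (TW.isPerfect_ΦR (op A)))
    (Lemma35.isPerfect_perfSaturation (TW.isPerfect_ΦR _) _)

/-- The datum's own `Φ_W^ell` restricted along the identity functor has the same values ("`D_W, D_X, D_Y, D_U`
are special cases of '`D_α`' [obtained by taking '`α`' to be the identity morphism …]", p. 85, at the level of
`SubMonoidOn.restrict`). [cite: MochizukiEtTh2009, Ex 3.9 p.85] -/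
theorem restrict_id_carrier (A : DWᵒᵖ) : (E.ΦellW.restrict (𝟭 DW)).carrier A = E.ΦellW.carrier A := rfl

/-- Restriction is transitive on values: `(Φ|_{L})|_{L'} = Φ|_{L' ⋙ L}` objectwise (so `Φ_α^ell = Φ_W^ell|_{D_α}` of
(iv) may equally be read as a restriction of `Φ^ell_{W^ell}` of (iii)). [cite: MochizukiEtTh2009, Ex 3.9 p.85] -/
theorem restrict_restrict_carrier {D₁ : Type u'} [Category.{v'} D₁] {D₂ : Type u₀} [Category.{v₀} D₂]
    (L : D₁ ⥤ DW) (L' : D₂ ⥤ D₁) (A : D₂ᵒᵖ) :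
    ((E.ΦellW.restrict L).restrict L').carrier A = (E.ΦellW.restrict (L' ⋙ L)).carrier A := rfl

end Example39Data

end Literature.AnabelianGeometry.EtaleTheta
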